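import Mathlib.Combinatorics.SetFamily.FourFunctions
import Mathlib.Tactic
import HarnessLib

/-!
# TP₂ survives mixing over an MTP₂ parameter (a Karlin–Rinott / Ahlswede–Daykin marginalisation step)

Support file for the Sahi / Conjecture-P programme of route `PercNearOneGluingNoHeavy`
(`--supports stmt-CriticalPhenomena-4575`, prover prim-l12-p5 gen 26; proof note
`prim-l12-p5/CORE-g26.md` §2).  No definitions, no named facts, no sorries.

Setting (note §2).  The single-type de Finetti partition function has the Gamma-moment representation
`Zc(a,c) = (n-1)!/Γ(θ) · E[(W₁+⋯+W_a+W'₁+⋯+W'_c)^θ]`, and its `θ`-free density version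
`N_s(a,c) = Γ(β+n) · E[s^K / Γ(β+K)]` (`K` = number of hit points) satisfies
`∫ s^{β+θ-1} e^{-s} N_s(a,c) ds = Γ(β) · M_θ(a,c)`.  Hence the mixed log-supermodularity
(`LSM-Z-2D`) of `M_θ` in `(a,c)` for EVERY `θ > 0` follows from three two-variable facts about the
family `s ↦ N_s(·,·)`: TP₂ in `(a,c)` at each level `s` (the CORE LEMMA of the note), and monotonicity of
the two ratios `N_s(a+1,c+1)/N_s(a,c+1)` and `N_s(a,c+1)/N_s(a,c)` in `s` (lr-order, note §2.2).  The
present file is the abstract marginalisation step, for a finite totally ordered parameter set (the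
continuous mixture is recovered by Riemann sums / monotone limits outside Lean):

* `cross_le` : the three hypotheses give the four-functions hypothesis
  `f₁₀ s · f₀₁ s' ≤ f₀₀ (s ⊓ s') · f₁₁ (s ⊔ s')`;
* `tp2_of_mixture` : by Mathlib's `four_functions_theorem_univ` (Ahlswede–Daykin on the chain),
  `(∑ f₁₀)(∑ f₀₁) ≤ (∑ f₀₀)(∑ f₁₁)`, i.e. the mixed array `(a,c) ↦ ∑_s w(s) N_s(a,c)` is again TP₂
  (the weights `w(s) > 0` are absorbed into the four functions).

Here `f₀₀, f₁₀, f₀₁, f₁₁ : ι → ℝ` stand for `s ↦ N_s(a,c), N_s(a+1,c), N_s(a,c+1), N_s(a+1,c+1)`.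
-/

namespace Summit.CriticalPhenomena.PercolationContinuityZ3.Theorems

namespace MixtureTP2

open Finset

variable {ι : Type*} [LinearOrder ι]
variable (f₀₀ f₁₀ f₀₁ f₁₁ : ι → ℝ)

/-- The four-functions hypothesis on a chain, from: TP₂ of the `2 × 2` square at every level `s`
(`hac`), the ratio `f₁₁/f₀₁` nondecreasing along the chain (`has`) and the ratio `f₀₁/f₀₀`
nondecreasing along the chain (`hcs`).  All four functions are assumed positive. -/
theorem cross_le (p₀₀ : ∀ s, 0 < f₀₀ s) (p₀₁ : ∀ s, 0 < f₀₁ s) (p₁₁ : ∀ s, 0 < f₁₁ s)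
    (hac : ∀ s, f₁₀ s * f₀₁ s ≤ f₀₀ s * f₁₁ s)
    (has : ∀ s s', s ≤ s' → f₁₁ s * f₀₁ s' ≤ f₀₁ s * f₁₁ s')
    (hcs : ∀ s s', s ≤ s' → f₀₁ s * f₀₀ s' ≤ f₀₀ s * f₀₁ s') (s s' : ι) :
    f₁₀ s * f₀₁ s' ≤ f₀₀ (s ⊓ s') * f₁₁ (s ⊔ s') := by
  rcases le_total s s' with h | h
  · -- `s ≤ s'`: combine `hac s` with `has s s'` and cancel `f₀₁ s * f₁₁ s > 0`.
    rw [inf_eq_left.mpr h, sup_eq_right.mpr h]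
    have h1 := hac s
    have h2 := has s s' h
    have hpos : 0 < f₀₁ s * f₁₁ s := mul_pos (p₀₁ s) (p₁₁ s)
    -- (f₁₀ s f₀₁ s') (f₀₁ s f₁₁ s) ≤ (f₀₀ s f₁₁ s') (f₀₁ s f₁₁ s)
    have key : (f₁₀ s * f₀₁ s') * (f₀₁ s * f₁₁ s) ≤ (f₀₀ s * f₁₁ s') * (f₀₁ s * f₁₁ s) := by
      have e1 : (f₁₀ s * f₀₁ s') * (f₀₁ s * f₁₁ s) = (f₁₀ s * f₀₁ s) * (f₁₁ s * f₀₁ s') := by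
        ring
      have e2 : (f₀₀ s * f₁₁ s') * (f₀₁ s * f₁₁ s) = (f₀₀ s * f₁₁ s) * (f₀₁ s * f₁₁ s') := by
        ring
      rw [e1, e2]
      exact mul_le_mul h1 h2 (mul_nonneg (p₁₁ s).le (p₀₁ s').le)
        (mul_nonneg (p₀₀ s).le (p₁₁ s).le)
    exact le_of_mul_le_mul_right key hpos
  · -- `s' ≤ s`: combine `hac s` with `hcs s' s` and cancel `f₀₁ s * f₀₀ s > 0`.
    rw [inf_eq_right.mpr h, sup_eq_left.mpr h]
    have h1 := hac s
    have h2 := hcs s' s h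
    have hpos : 0 < f₀₁ s * f₀₀ s := mul_pos (p₀₁ s) (p₀₀ s)
    have key : (f₁₀ s * f₀₁ s') * (f₀₁ s * f₀₀ s) ≤ (f₀₀ s' * f₁₁ s) * (f₀₁ s * f₀₀ s) := by
      have e1 : (f₁₀ s * f₀₁ s') * (f₀₁ s * f₀₀ s) = (f₁₀ s * f₀₁ s) * (f₀₁ s' * f₀₀ s) := by
        ring
      have e2 : (f₀₀ s' * f₁₁ s) * (f₀₁ s * f₀₀ s) = (f₀₀ s * f₁₁ s) * (f₀₀ s' * f₀₁ s) := by
        ring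
      rw [e1, e2]
      exact mul_le_mul h1 h2 (mul_nonneg (p₀₁ s').le (p₀₀ s).le)
        (mul_nonneg (p₀₀ s).le (p₁₁ s).le)
    exact le_of_mul_le_mul_right key hpos

/-- **TP₂ survives mixing over an MTP₂ parameter.**  On a finite chain `ι`, if the square
`(f₀₀ s, f₁₀ s, f₀₁ s, f₁₁ s)` is TP₂ at every level, `f₁₁/f₀₁` and `f₀₁/f₀₀` are nondecreasing
along the chain and all four functions are positive, then the summed square is TP₂:
`(∑ f₁₀)(∑ f₀₁) ≤ (∑ f₀₀)(∑ f₁₁)`.  This is the Ahlswede–Daykin four functions theorem on the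
distributive lattice `ι` (Mathlib `four_functions_theorem_univ`) fed with `cross_le`. -/
theorem tp2_of_mixture [Fintype ι] (p₀₀ : ∀ s, 0 < f₀₀ s) (p₁₀ : ∀ s, 0 < f₁₀ s)
    (p₀₁ : ∀ s, 0 < f₀₁ s) (p₁₁ : ∀ s, 0 < f₁₁ s)
    (hac : ∀ s, f₁₀ s * f₀₁ s ≤ f₀₀ s * f₁₁ s)
    (has : ∀ s s', s ≤ s' → f₁₁ s * f₀₁ s' ≤ f₀₁ s * f₁₁ s')
    (hcs : ∀ s s', s ≤ s' → f₀₁ s * f₀₀ s' ≤ f₀₀ s * f₀₁ s') :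
    (∑ s, f₁₀ s) * (∑ s, f₀₁ s) ≤ (∑ s, f₀₀ s) * (∑ s, f₁₁ s) := by
  classical
  exact four_functions_theorem_univ f₁₀ f₀₁ f₀₀ f₁₁ (fun s => (p₁₀ s).le) (fun s => (p₀₁ s).le)
    (fun s => (p₀₀ s).le) (fun s => (p₁₁ s).le)
    (cross_le f₀₀ f₁₀ f₀₁ f₁₁ p₀₀ p₀₁ p₁₁ hac has hcs)

end MixtureTP2

end Summit.CriticalPhenomena.PercolationContinuityZ3.Theorems
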